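import Summits.BirchSwinnertonDyer.BirchSwinnertonDyer.Theorems.ErratumRoadFiveSkinnerZhang13ByName
import Summits.BirchSwinnertonDyer.Rank1Residual.X11b.Three.OpenInputTightLocus
import Literature.NumberTheory.EllipticCurves.HeegnerPointsOfConductorOneGaloisConjProofs
import Literature.NumberTheory.GaloisRepresentations.NumberFieldCdTwoProofs
import HarnessLib

/-!
# Rung K2 at `p ≥ 5` (class X11b, board atom B9): Skinner–Zhang 2014 Thm. 1.3 BY LITERATURE NAME ⟹
# `BSD(E,p)` and ⟹ THE open input of route p2 — the DISCHARGED forms (Shimura reciprocity supplied;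
# no control hypothesis) (cell `bsd-stepL`, seat `bsd-stepL-mult-p3`, session g2;
# `--supports stmt-BirchSwinnertonDyer-19703`)

HONEST FRAMING (cell `bsd-stepL`, HOME `run/shared/lean/pub/bsd-stepL/`): CONDITIONAL on the OPEN
Literature binder `SkinnerZhang2014.thm1_3_exists_kolyvaginClass_one_ne_zero_OPEN` (arXiv:1407.1099v1
Thm. 1.3 at `N⁻ = 1`; UNREFEREED since 2014; `[claim: SkinnerZhang2014, status: under-review]`) and on
the named fact `McCallum1991_pow_dvd_card_sha_primary_of_certificate` plus PUBLISHED named facts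
(Gross–Zagier, Kolyvagin ×2, Skinner 2016 Thm. C, GZK, modularity ×2, Hoffstein–Luo, Mazur's Manin
constant) and — for the open-input form only — three CITED cohomological facts (local Euler
characteristic, Poitou–Tate for Selmer structures, Poitou–Tate `Ш ↔` Tate dual). Nothing is booked;
X11b stays CONSTRUCTION-SHAPED (T7); BSD is proved for no curve unconditionally; beyond-print theorem: NO.

WHAT THIS FILE ADDS to `ErratumRoadFiveSkinnerZhang13ByName` (session g0, p537865 ∕ p538610):
(a) the Shimura-reciprocity binder `hrec` (conductor `1`; Darmon 2004 Thm. 3.7 ∕ Gross 1991 §4) of the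
B9 leaf theorem `bsdp_of_skinnerZhang13_OPEN_of_mccallum'` is a tree THEOREM
(`heegnerPointOfConductor_one_galoisConj_holds`, `HeegnerPointsOfConductorOneGaloisConjProofs`,
2026-08-27) and is SUPPLIED here: `bsdp_of_skinnerZhang13_OPEN_of_mccallum''`;
(b) the control hypothesis `hC : P2ControlOnTreeAt W p` of g0's §3
(`openInputOnTreeAt_of_skinnerZhang13_OPEN_of_mccallum_of_control`) is NOT needed: x11b3's
`Three/ControlIdentityLocus` ∕ `Three/OpenInputTightLocus` (cell `b2b-bsdres`, 2026-08-21) prove the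
anticyclotomic control identity (Castella 2018 Thm. 2.3 ∕ JSW 2017 Thm. 3.3.1 on the constructed `X_ac`)
on the WHOLE Locus X11b ∧ (ram) ∧ `p ∤ ∏c` at every odd `p` from Kolyvagin + the three cited facts
(`cd_p ≤ 2` being the tree theorem `fieldCdLE_two_of_numberField_holds`):
`openInputOnTreeOddAt_of_skinnerZhang13_OPEN_of_mccallum_of_facts` (odd form, the stronger currency) and
`openInputOnTreeAt_of_skinnerZhang13_OPEN_of_mccallum_of_facts` (the `p ≥ 5` form quoted by K2's items).
READING: two PRE claims of the B9 cell — SZ14 Thm. 1.3, and Castella's erratum (2.4) «by [FW21, Thm.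
4.41]» whose tree consequence is THE open input `P2OpenInputOnTreeAt` — are LINKED in the kernel on their
common locus (Thm. 1.3's printed hypotheses at `N⁻ = 1`): the first implies the second's consequence,
from McCallum + published ∕ cited facts, with no control, Selmer, local or side-condition binder.

References: [SkinnerZhang2014] Thm. 1.3 (§1); [McCallumLMS1991] §5 Cor. 5.6; [Darmon2004] Thm. 3.7;
[Castella2018] Thms. 2.3, 3.2; [Castella2018Erratum] (2.4); [JetchevSkinnerWan2017] Thm. 3.3.1, §7.4.1;
[Skinner2016PacificMC] Thm. C; [SerreGaloisCohomology1997] II §4.4 Prop. 13; [Miller2011LMS] Def. 1.1.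
-/

set_option autoImplicit false

noncomputable section

open scoped Classical NumberField

namespace Summit.BirchSwinnertonDyer.Rank1Residual.X11b.Three.Koly

open WeierstrassCurve NumberField IsDedekindDomain Literature.NumberTheory.EllipticCurves
  Literature.NumberTheory.EllipticCurves.ModularForms
  Literature.NumberTheory.EllipticCurves.Rank1Residual
  Literature.NumberTheory.GaloisRepresentations Literature.NumberTheory.GaloisCohomology
  Summit.BirchSwinnertonDyer.Rank1Residual Summit.BirchSwinnertonDyer.Rank1Residual.X11b

/-! ### §1 The B9 leaf theorem with Shimura reciprocity SUPPLIED -/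

/-- **B9 at `p ≥ 5`, `hrec` SUPPLIED: `BSD(E,p)` on SZ14 Thm. 1.3's printed locus** from the OPEN
Literature binder (Thm. 1.3 at `N⁻ = 1`, ∃-framed) + McCallum 1991 Cor. 5.6 + the published inputs
(Gross–Zagier, Kolyvagin ×2, Skinner 2016 Thm. C, GZK, modularity ×2, Hoffstein–Luo, Mazur's Manin
constant) — g0's `bsdp_of_skinnerZhang13_OPEN_of_mccallum'` with Shimura reciprocity at conductor `1`
discharged by the tree theorem `heegnerPointOfConductor_one_galoisConj_holds`. CONDITIONAL on `hSZ` (PRE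
claim) and `hMc`; nothing booked; X11b stays CONSTRUCTION-SHAPED. [claim: SkinnerZhang2014, status: under-review]
[cite: McCallumLMS1991, §5 Cor. 5.6 (p. 310)] [cite: Darmon2004, Thm. 3.7] [cite: Miller2011LMS, Def. 1.1] -/
theorem bsdp_of_skinnerZhang13_OPEN_of_mccallum''
    (hGZ : ∀ (N : ℕ) [NeZero N] (W : WeierstrassCurve ℚ) (K : Type) [Field K] [NumberField K],
      gross_zagier N W K)
    (hKo : ∀ (N : ℕ) [NeZero N] (W : WeierstrassCurve ℚ) (K : Type) [Field K] [NumberField K],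
      kolyvagin N W K)
    (hB : ∀ (N : ℕ) [NeZero N] (W : WeierstrassCurve ℚ) (K : Type) [Field K] [NumberField K],
      Kolyvagin1990_padicValNat_card_sha_le N W K)
    (hSk : Skinner2016.thmC_padicValRat_bsd_rank_zero)
    (hGZK : rank_eq_analyticRank_of_analyticRank_le_one) (hmod : hasEntireLFunction_rat)
    (hnf : exists_isNewformOf) (hHL : HoffsteinLuo1997_exists_twist_L_one_ne_zero)
    (hMaz : mazur_not_dvd_maninConstant_of_odd)
    (hMc : McCallum1991_pow_dvd_card_sha_primary_of_certificate)
    (hSZ : SkinnerZhang2014.thm1_3_exists_kolyvaginClass_one_ne_zero_OPEN)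
    (W : WeierstrassCurve ℚ) [W.IsElliptic] [W.IsGloballyMinimal] (p : ℕ) [Fact p.Prime]
    (hX : ClassX11b W p) (hp5 : 5 ≤ p)
    (hfin : ¬ p ∣ padicValInt p W.minimalDiscriminantInt)
    (hlog : W.HasSplitMultiplicativeReductionAtPrime p →
      ∀ D : TateParameterData W p, (padicLog p D.q).valuation = 1)
    (hramAll : ∀ (ℓ : ℕ) [Fact ℓ.Prime], ℓ ≠ p → W.HasMultiplicativeReductionAtPrime ℓ →
      ¬ p ∣ padicValInt ℓ W.minimalDiscriminantInt)
    (hram : Ram W p) : BSDp W p :=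
  bsdp_of_skinnerZhang13_OPEN_of_mccallum' hGZ hKo hB hSk hGZK hmod hnf hHL hMaz
    (fun N _ W K _ _ ↦ heegnerPointOfConductor_one_galoisConj_holds N W K) hMc hSZ W p hX hp5 hfin hlog
    hramAll hram

/-! ### §2 THE open input of route p2 from SZ14 Thm. 1.3, WITHOUT the control hypothesis -/

/-- **SZ14 Thm. 1.3 BY NAME ⟹ THE open input of route p2 in its ODD form `P2OpenInputOnTreeOddAt W p`, on
the Thm-1.3 locus at `p ≥ 5`, WITHOUT the control hypothesis** — g0's §3 with `hC` DISCHARGED: `BSD(E,p)` by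
§1's leaf theorem, then x11b3's tightness on the WHOLE Locus with the control identity re-proved on the
constructed `X_ac` (`P2.openInputOnTreeOddAt_of_bsdp_of_locus_of_facts`: Castella 2018 Thm. 2.3 ∕ JSW 2017
Thm. 3.3.1 from Kolyvagin + the cited local Euler characteristic ∕ Poitou–Tate ×2 facts `hEP hPTs hPT2`;
`cd_p ≤ 2` supplied by `fieldCdLE_two_of_numberField_holds`; `p ∤ ∏c` by g0's `not_dvd_tamagawaProduct_of_szHypotheses`). So on the common
locus the tree consequence of Castella's erratum (2.4) [⟸ FW21 Thm. 4.41, PRE] follows from SZ14 Thm. 1.3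
[PRE] + McCallum + published ∕ cited facts. CONDITIONAL on `hSZ`, `hMc`; nothing booked.
[claim: SkinnerZhang2014, status: under-review] [cite: Castella2018, Thm. 2.3 (p. 5), Thm. 3.2 (p. 9)]
[cite: Castella2018Erratum, (2.4) (p. 1)] [cite: JetchevSkinnerWan2017, Thm. 3.3.1 (p. 11), §7.4.1 (pp. 30–31)]
[cite: McCallumLMS1991, §5 Cor. 5.6 (p. 310)] -/
theorem openInputOnTreeOddAt_of_skinnerZhang13_OPEN_of_mccallum_of_facts
    (hGZ : ∀ (N : ℕ) [NeZero N] (W : WeierstrassCurve ℚ) (K : Type) [Field K] [NumberField K],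
      gross_zagier N W K)
    (hKo : ∀ (N : ℕ) [NeZero N] (W : WeierstrassCurve ℚ) (K : Type) [Field K] [NumberField K],
      kolyvagin N W K)
    (hB : ∀ (N : ℕ) [NeZero N] (W : WeierstrassCurve ℚ) (K : Type) [Field K] [NumberField K],
      Kolyvagin1990_padicValNat_card_sha_le N W K)
    (hSk : Skinner2016.thmC_padicValRat_bsd_rank_zero)
    (hGZK : rank_eq_analyticRank_of_analyticRank_le_one) (hmod : hasEntireLFunction_rat)
    (hnf : exists_isNewformOf) (hHL : HoffsteinLuo1997_exists_twist_L_one_ne_zero)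
    (hMaz : mazur_not_dvd_maninConstant_of_odd)
    (hMc : McCallum1991_pow_dvd_card_sha_primary_of_certificate)
    -- cited cohomological facts feeding the control identity on the whole Locus (x11b3 `ControlIdentityLocus`)
    (hEP : ∀ (K : Type) [Field K] [NumberField K] (v : HeightOneSpectrum (𝓞 K)),
      localEulerPoincareCharacteristic (v.adicCompletion K))
    (hPTs : ∀ (K : Type) [Field K] [NumberField K],
      poitouTate_selmerStructure_duality K)
    (hPT2 : ∀ (K : Type) [Field K] [NumberField K],
      poitouTate_sha_tateDual K)
    (hSZ : SkinnerZhang2014.thm1_3_exists_kolyvaginClass_one_ne_zero_OPEN)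
    (W : WeierstrassCurve ℚ) [W.IsElliptic] [W.IsGloballyMinimal] (p : ℕ) [Fact p.Prime]
    (hX : ClassX11b W p) (hp5 : 5 ≤ p)
    (hfin : ¬ p ∣ padicValInt p W.minimalDiscriminantInt)
    (hlog : W.HasSplitMultiplicativeReductionAtPrime p →
      ∀ D : TateParameterData W p, (padicLog p D.q).valuation = 1)
    (hramAll : ∀ (ℓ : ℕ) [Fact ℓ.Prime], ℓ ≠ p → W.HasMultiplicativeReductionAtPrime ℓ →
      ¬ p ∣ padicValInt ℓ W.minimalDiscriminantInt)
    (hram : Ram W p) : P2OpenInputOnTreeOddAt W p :=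
  have htam : ¬ p ∣ W.tamagawaProduct := not_dvd_tamagawaProduct_of_szHypotheses W (Fact.out) hp5 hfin hramAll
  P2.openInputOnTreeOddAt_of_bsdp_of_locus_of_facts W p hGZ hKo hSk hGZK hmod hEP hPTs hPT2
    fieldCdLE_two_of_numberField_holds hX hram htam
    (bsdp_of_skinnerZhang13_OPEN_of_mccallum'' hGZ hKo hB hSk hGZK hmod hnf hHL hMaz hMc hSZ W p hX hp5 hfin
      hlog hramAll hram)

/-- **The same in the `p ≥ 5` currency `P2OpenInputOnTreeAt W p`** (THE open input of route p2 as K2's items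
quote it; the odd form drops the antecedent `5 ≤ p`, `p2OpenInputOnTreeAt_of_odd`) — g0's
`openInputOnTreeAt_of_skinnerZhang13_OPEN_of_mccallum_of_control` with BOTH `hC` and `hrec` discharged.
CONDITIONAL on `hSZ`, `hMc`; nothing booked. [claim: SkinnerZhang2014, status: under-review]
[cite: Castella2018, Thm. 2.3 (p. 5), Thm. 3.2 (p. 9)] [cite: Castella2018Erratum, (2.4) (p. 1)]
[cite: JetchevSkinnerWan2017, Thm. 3.3.1 (p. 11), §7.4.1 (pp. 30–31)] -/
theorem openInputOnTreeAt_of_skinnerZhang13_OPEN_of_mccallum_of_facts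
    (hGZ : ∀ (N : ℕ) [NeZero N] (W : WeierstrassCurve ℚ) (K : Type) [Field K] [NumberField K],
      gross_zagier N W K)
    (hKo : ∀ (N : ℕ) [NeZero N] (W : WeierstrassCurve ℚ) (K : Type) [Field K] [NumberField K],
      kolyvagin N W K)
    (hB : ∀ (N : ℕ) [NeZero N] (W : WeierstrassCurve ℚ) (K : Type) [Field K] [NumberField K],
      Kolyvagin1990_padicValNat_card_sha_le N W K)
    (hSk : Skinner2016.thmC_padicValRat_bsd_rank_zero)
    (hGZK : rank_eq_analyticRank_of_analyticRank_le_one) (hmod : hasEntireLFunction_rat)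
    (hnf : exists_isNewformOf) (hHL : HoffsteinLuo1997_exists_twist_L_one_ne_zero)
    (hMaz : mazur_not_dvd_maninConstant_of_odd)
    (hMc : McCallum1991_pow_dvd_card_sha_primary_of_certificate)
    (hEP : ∀ (K : Type) [Field K] [NumberField K] (v : HeightOneSpectrum (𝓞 K)),
      localEulerPoincareCharacteristic (v.adicCompletion K))
    (hPTs : ∀ (K : Type) [Field K] [NumberField K],
      poitouTate_selmerStructure_duality K)
    (hPT2 : ∀ (K : Type) [Field K] [NumberField K],
      poitouTate_sha_tateDual K)
    (hSZ : SkinnerZhang2014.thm1_3_exists_kolyvaginClass_one_ne_zero_OPEN)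
    (W : WeierstrassCurve ℚ) [W.IsElliptic] [W.IsGloballyMinimal] (p : ℕ) [Fact p.Prime]
    (hX : ClassX11b W p) (hp5 : 5 ≤ p)
    (hfin : ¬ p ∣ padicValInt p W.minimalDiscriminantInt)
    (hlog : W.HasSplitMultiplicativeReductionAtPrime p →
      ∀ D : TateParameterData W p, (padicLog p D.q).valuation = 1)
    (hramAll : ∀ (ℓ : ℕ) [Fact ℓ.Prime], ℓ ≠ p → W.HasMultiplicativeReductionAtPrime ℓ →
      ¬ p ∣ padicValInt ℓ W.minimalDiscriminantInt)
    (hram : Ram W p) : P2OpenInputOnTreeAt W p :=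
  p2OpenInputOnTreeAt_of_odd
    (openInputOnTreeOddAt_of_skinnerZhang13_OPEN_of_mccallum_of_facts hGZ hKo hB hSk hGZK hmod hnf hHL hMaz
      hMc hEP hPTs hPT2 hSZ W p hX hp5 hfin hlog hramAll hram)

end Summit.BirchSwinnertonDyer.Rank1Residual.X11b.Three.Koly

end
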